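import Summits.BirchSwinnertonDyer.BirchSwinnertonDyer.Theorems.SlopeDichotomyA2DegenerateLocusA2IsogenyClass
import Literature.NumberTheory.EllipticCurves.OpenImage
import HarnessLib

/-!
# The PRIME SUPPORT of corner A2: the crux `DegenerateLocusA2` (item stmt-BirchSwinnertonDyer-19086)
# is a statement at the eleven odd Mazur primes only — WLOG `p ∈ {3,5,7,11,13,17,19,37,43,67,163}` and
# WLOG `E` without complex multiplication

Support file (prover seat `bsd-schneider-i1-c2`, gen 10, cell `bsd-schneider-ideate`; `--supports
stmt-BirchSwinnertonDyer-19086`). THEOREMS ONLY, conditional on named PUBLISHED facts (Mazur 1978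
Thm. 1 `mazur_isogeny_irreducible`; Bertrand 1982/84 `bertrand_pairing_self_ne_zero_of_hasCM_odd`;
Gross–Zagier–Kolyvagin `rank_eq_analyticRank_of_analyticRank_le_one`); nothing unconditional about any
curve, nothing booked. Companion of gens 0–9 (`…Concrete`, `…AnticyclotomicRoad`, `…Placement`,
`…PrintPlacement`, `…OrderParity`, `…RegulatorFloor*`, `…HeightIntegrality*`, `…ValueSubgroup*`,
`…CoLine`, `…TamagawaClass`, `…IsogenyClass`); the item's verdict (DECIDED-REDUCED: 19086 ⟸ 19036,
19086 ⟺ 19035 modulo Keller–Yin Thm. 3.0.8 + PUB) is unchanged.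

THE POINT (director D-0074 (K): «the degenerate locus … is empty/finite per class; refutation budget
first»). A corner-A2 pair `(E,p)` (`X1.TypeBRankOne`: `p > 2` good anomalous, `E[p]` REDUCIBLE,
Greenberg–Vatsal parity, `ord_{s=1} L(E,s) = 1`) carries a rational `p`-isogeny, so by Mazur's theorem on
rational isogenies of prime degree `p` is one of the eleven odd Mazur primes
`{3, 5, 7, 11, 13, 17, 19, 37, 43, 67, 163}` (`two_lt_and_mem_mazurPrimes_of_typeBRankOne`,
`mem_oddMazurPrimes_of_typeBRankOne`, `prime_le_163_of_typeBRankOne`). Hence the crux — and K5's crux 6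
`EisensteinPrimes.SchneiderOnX1TypeB` (item 19036), and the rung leaf `TypeBRankOneUnridered` — are
FINITE CONJUNCTIONS over these primes (`degenerateLocusA2_iff_of_mem_oddMazurPrimes`,
`schneiderOnX1TypeB_iff_of_mem_oddMazurPrimes`, `typeBRankOneUnridered_iff_of_mem_oddMazurPrimes`), and
on the CM members of the corner (if any) the crux is vacuous by Bertrand
(`not_degenerate_of_hasCM_of_typeBRankOne`, `degenerateLocusA2_iff_nonCM_of_mem_oddMazurPrimes`,
`schneiderOnX1TypeB_iff_nonCM_of_mem_oddMazurPrimes`).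

REMARK (numbers, NOT typed here; kit PARI job j267726 of this seat, PARI 2.17.3, evidence on the item). By
Mazur 1978 + Kenku the non-cuspidal rational points of `X₀(p)` for `p ∈ {11, 17, 19, 37, 43, 67, 163}` are
finitely many (`j ∈ {−2¹⁵, −11², −11·131³}`, `{−17²·101³/2, −17·373³/2¹⁷}`, `{−2¹⁵3³}`, `{−7·11³,
−7·137³·2083³}`, `{−2¹⁸3³5³}`, `{−2¹⁵3³5³11³}`, `{−2¹⁸3³5³23³29³}`); the job tests, for one curve per `j`
and each of the four classes of `ℚ_p^×/ℚ_p^{×2}` (the reduction type at `p` of a quadratic twist depends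
only on that class), whether a good ORDINARY model with `a_p ≡ ±1 (mod p)` exists — the necessary and
sufficient condition for corner A2 to be NON-EMPTY at `p` (the sign of `a_p`, the parity of the kernel
character and the root number are then adjusted by twists `d` with `p ∤ d`). RESULT: at `p = 11, 17` every
twist is ADDITIVE at `p` (minimal twists of conductor `121 = 11²` resp. `14450 = 2·5²·17²`; Kodaira
II/III/IV ↔ IV*/III*/II* over the four classes); at `p = 19, 43, 67, 163` the points are CM (minimal twists
of conductor `p²`) and every twist is additive at `p` (III ↔ III*); at `p = 37` the two curves of conductor
`1225 = 35²` (`[1,1,1,−8,6]` = Cremona `1225h1`, and `[1,1,1,−208083,−36621194]`) and their prime-to-`37`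
twists are GOOD ORDINARY at `37` with `a₃₇ = ±8 ≢ ±1 (mod 37)` — NOT anomalous — and the `37 ∣ d`
twists are additive (I₀*). HENCE CORNER A2 LIVES EXACTLY AT `p ∈ {3, 5, 7, 13}` (the odd primes
with `X₀(p)` of genus `0`; census N < 5·10⁵: 2 444 / 292 / 53 / 8 class-pairs), and the crux is in fact a
conjunction of FOUR statements. Typing the refinement `{3,…,163} → {3,5,7,13}` would need the `X₀(p)(ℚ)`
`j`-lists and the local data above as cite-tagged facts; it is recorded here as a remark only, and none of
it is used below.

References: [Mazur1978] Thm. 1; [Bertrand1984ThetaCM] §3 Cor. 1; [GrossZagier1986]/[Kolyvagin1990]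
(GZK as the tree's named fact); cell files `run/shared/lean/pub/bsd-schneider-ideate/memos/i1-c2/`.
-/

set_option autoImplicit false
set_option linter.dupNamespace false

noncomputable section

open scoped Classical

open WeierstrassCurve Literature.NumberTheory.EllipticCurves
  Literature.NumberTheory.EllipticCurves.Rank1Residual
  Summit.BirchSwinnertonDyer.Rank1Residual

namespace Summit.BirchSwinnertonDyer.BirchSwinnertonDyer.Theorems.DegenerateLocusA2PrimeSupport

/-! ## §1 The prime support of corner A2 (Mazur 1978) -/

/-- **The eleven odd Mazur primes** `{3, 5, 7, 11, 13, 17, 19, 37, 43, 67, 163}` are `mazurPrimes`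
minus `2` (written as a literal `Finset` throughout this file; no definition is introduced).
[cite: Mazur1978, Thm 1] -/
theorem mem_oddMazurPrimes_iff {p : ℕ} :
    p ∈ ({3, 5, 7, 11, 13, 17, 19, 37, 43, 67, 163} : Finset ℕ) ↔ p ∈ mazurPrimes ∧ p ≠ 2 := by
  simp only [mazurPrimes, Finset.mem_insert, Finset.mem_singleton]
  omega

/-- **A corner-A2 pair lives at an odd Mazur prime**: `X1.TypeBRankOne W p` contains `2 < p` and
`Red W p` (a rational `p`-isogeny), so Mazur's theorem (`mazur_isogeny_irreducible`, Mazur 1978 Thm. 1,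
as a named hypothesis) puts `p` in `mazurPrimes`. [cite: Mazur1978, Thm 1] -/
theorem two_lt_and_mem_mazurPrimes_of_typeBRankOne (hM : mazur_isogeny_irreducible)
    (W : WeierstrassCurve ℚ) [W.IsElliptic] [W.IsGloballyMinimal] (p : ℕ) [Fact p.Prime]
    (hB : X1.TypeBRankOne W p) : 2 < p ∧ p ∈ mazurPrimes := by
  obtain ⟨⟨h2, hRed, -⟩, -⟩ := hB
  refine ⟨h2, ?_⟩
  by_contra hp
  exact hRed (hM W p Fact.out hp)

/-- **Corner A2 is supported on the eleven odd Mazur primes.** [cite: Mazur1978, Thm 1] -/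
theorem mem_oddMazurPrimes_of_typeBRankOne (hM : mazur_isogeny_irreducible)
    (W : WeierstrassCurve ℚ) [W.IsElliptic] [W.IsGloballyMinimal] (p : ℕ) [Fact p.Prime]
    (hB : X1.TypeBRankOne W p) :
    p ∈ ({3, 5, 7, 11, 13, 17, 19, 37, 43, 67, 163} : Finset ℕ) := by
  obtain ⟨h2, hp⟩ := two_lt_and_mem_mazurPrimes_of_typeBRankOne hM W p hB
  exact mem_oddMazurPrimes_iff.2 ⟨hp, by omega⟩

/-- In particular `p ≤ 163` at every corner-A2 pair. [cite: Mazur1978, Thm 1] -/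
theorem prime_le_163_of_typeBRankOne (hM : mazur_isogeny_irreducible)
    (W : WeierstrassCurve ℚ) [W.IsElliptic] [W.IsGloballyMinimal] (p : ℕ) [Fact p.Prime]
    (hB : X1.TypeBRankOne W p) : p ≤ 163 :=
  le_of_mem_mazurPrimes (two_lt_and_mem_mazurPrimes_of_typeBRankOne hM W p hB).2

/-! ## §2 CM members of the corner are never degenerate (Bertrand) -/

/-- **At a corner-A2 pair on a CM curve THE canonical height is non-degenerate** (Bertrand 1982/84 at
an odd good ordinary prime, the tree's `SchneiderWeaken.not_degenerate_of_hasCM`, with the Mordell–Weil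
rank `1` supplied by Gross–Zagier–Kolyvagin from `ord_{s=1} L(E,s) = 1`). So the crux's hypothesis is
never met on CM members of corner A2 — recorded, as in the leaf file, NOT as a witness of weakness.
[cite: Bertrand1984ThetaCM, §3 Corollaire 1 (p. 21)] -/
theorem not_degenerate_of_hasCM_of_typeBRankOne (hBer : bertrand_pairing_self_ne_zero_of_hasCM_odd)
    (hGZK : rank_eq_analyticRank_of_analyticRank_le_one)
    (W : WeierstrassCurve ℚ) [W.IsElliptic] [W.IsGloballyMinimal] (p : ℕ) [Fact p.Prime]
    (hCM : W.HasCM) (hB : X1.TypeBRankOne W p) :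
    ¬ ∃ Dh : PAdicHeightData W p, Dh.IsCanonical ∧ ¬ SchneiderConjecture Dh := by
  have hX := isClassX1_of_classX1 hB.1
  have hrank : W.mordellWeilRank = 1 := by
    have h := (hGZK W (le_of_eq hB.2.1)).1
    rw [h, hB.2.1]
  exact SchneiderWeaken.not_degenerate_of_hasCM hBer W hCM p hX.two_ne hX.hasGoodReductionAtPrime
    hX.not_dvd_frobeniusTrace hrank

/-! ## §3 WLOG forms of the crux `DegenerateLocusA2` (item 19086), BY NAME -/

/-- **WLOG `p` an odd Mazur prime.** The crux `SlopeDichotomyA2.DegenerateLocusA2` is EQUIVALENT to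
its restriction to `p ∈ {3, 5, 7, 11, 13, 17, 19, 37, 43, 67, 163}` — a finite conjunction of eleven
statements, one per prime (granted Mazur 1978 Thm. 1 as the named hypothesis `hM`).
[cite: Mazur1978, Thm 1] -/
theorem degenerateLocusA2_iff_of_mem_oddMazurPrimes (hM : mazur_isogeny_irreducible) :
    Theses.SlopeDichotomyA2.DegenerateLocusA2 ↔
      ∀ (W : WeierstrassCurve ℚ) [W.IsElliptic] [W.IsGloballyMinimal] (p : ℕ) [Fact p.Prime],
        p ∈ ({3, 5, 7, 11, 13, 17, 19, 37, 43, 67, 163} : Finset ℕ) → X1.TypeBRankOne W p →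
          (∃ Dh : PAdicHeightData W p, Dh.IsCanonical ∧ ¬ SchneiderConjecture Dh) → BSDp W p := by
  refine ⟨fun h W _ _ p _ _ hB hD ↦ h W p hB hD, fun h W _ _ p _ hB hD ↦ ?_⟩
  exact h W p (mem_oddMazurPrimes_of_typeBRankOne hM W p hB) hB hD

/-- **WLOG `E` non-CM and `p` an odd Mazur prime.** The crux `SlopeDichotomyA2.DegenerateLocusA2` is
EQUIVALENT to its restriction to curves WITHOUT complex multiplication at the eleven odd Mazur primes
(the CM members are never degenerate, §2). [cite: Mazur1978, Thm 1]
[cite: Bertrand1984ThetaCM, §3 Corollaire 1 (p. 21)] -/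
theorem degenerateLocusA2_iff_nonCM_of_mem_oddMazurPrimes (hM : mazur_isogeny_irreducible)
    (hBer : bertrand_pairing_self_ne_zero_of_hasCM_odd)
    (hGZK : rank_eq_analyticRank_of_analyticRank_le_one) :
    Theses.SlopeDichotomyA2.DegenerateLocusA2 ↔
      ∀ (W : WeierstrassCurve ℚ) [W.IsElliptic] [W.IsGloballyMinimal] (p : ℕ) [Fact p.Prime],
        ¬ W.HasCM → p ∈ ({3, 5, 7, 11, 13, 17, 19, 37, 43, 67, 163} : Finset ℕ) → X1.TypeBRankOne W p →
          (∃ Dh : PAdicHeightData W p, Dh.IsCanonical ∧ ¬ SchneiderConjecture Dh) → BSDp W p := by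
  refine ⟨fun h W _ _ p _ _ _ hB hD ↦ h W p hB hD, fun h W _ _ p _ hB hD ↦ ?_⟩
  by_cases hCM : W.HasCM
  · exact absurd hD (not_degenerate_of_hasCM_of_typeBRankOne hBer hGZK W p hCM hB)
  · exact h W p hCM (mem_oddMazurPrimes_of_typeBRankOne hM W p hB) hB hD

/-! ## §4 The same normal forms for Schneider on corner A2 (K5 crux 6, item 19036) and for the leaf -/

/-- **Schneider on corner A2, WLOG `p` an odd Mazur prime**: K5's crux `EisensteinPrimes.SchneiderOnX1TypeB`
(item stmt-BirchSwinnertonDyer-19036) is EQUIVALENT to its restriction to the eleven odd Mazur primes.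
[cite: Mazur1978, Thm 1] -/
theorem schneiderOnX1TypeB_iff_of_mem_oddMazurPrimes (hM : mazur_isogeny_irreducible) :
    Theses.EisensteinPrimes.SchneiderOnX1TypeB ↔
      ∀ (W : WeierstrassCurve ℚ) [W.IsElliptic] [W.IsGloballyMinimal] (p : ℕ) [Fact p.Prime],
        p ∈ ({3, 5, 7, 11, 13, 17, 19, 37, 43, 67, 163} : Finset ℕ) → X1.TypeBRankOne W p →
          ∀ Dh : PAdicHeightData W p, Dh.IsCanonical → SchneiderConjecture Dh := by
  refine ⟨fun h W _ _ p _ _ hB Dh hDh ↦ h W p hB Dh hDh, fun h W _ _ p _ hB Dh hDh ↦ ?_⟩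
  exact h W p (mem_oddMazurPrimes_of_typeBRankOne hM W p hB) hB Dh hDh

/-- **Schneider on corner A2, WLOG `E` non-CM and `p` an odd Mazur prime** (the CM members satisfy
Schneider by Bertrand, §2). [cite: Mazur1978, Thm 1] [cite: Bertrand1984ThetaCM, §3 Corollaire 1 (p. 21)] -/
theorem schneiderOnX1TypeB_iff_nonCM_of_mem_oddMazurPrimes (hM : mazur_isogeny_irreducible)
    (hBer : bertrand_pairing_self_ne_zero_of_hasCM_odd)
    (hGZK : rank_eq_analyticRank_of_analyticRank_le_one) :
    Theses.EisensteinPrimes.SchneiderOnX1TypeB ↔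
      ∀ (W : WeierstrassCurve ℚ) [W.IsElliptic] [W.IsGloballyMinimal] (p : ℕ) [Fact p.Prime],
        ¬ W.HasCM → p ∈ ({3, 5, 7, 11, 13, 17, 19, 37, 43, 67, 163} : Finset ℕ) → X1.TypeBRankOne W p →
          ∀ Dh : PAdicHeightData W p, Dh.IsCanonical → SchneiderConjecture Dh := by
  refine ⟨fun h W _ _ p _ _ _ hB Dh hDh ↦ h W p hB Dh hDh, fun h W _ _ p _ hB Dh hDh ↦ ?_⟩
  by_cases hCM : W.HasCM
  · by_contra hS
    exact not_degenerate_of_hasCM_of_typeBRankOne hBer hGZK W p hCM hB ⟨Dh, hDh, hS⟩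
  · exact h W p hCM (mem_oddMazurPrimes_of_typeBRankOne hM W p hB) hB Dh hDh

/-- **The rung-I1 leaf, WLOG `p` an odd Mazur prime**: `SchneiderWeaken.TypeBRankOneUnridered`
(`BSD(E,p)` on all of corner A2) is EQUIVALENT to its restriction to the eleven odd Mazur primes.
(No CM reduction here: `BSD(E,p)` on a CM member of A2 is not free.) [cite: Mazur1978, Thm 1] -/
theorem typeBRankOneUnridered_iff_of_mem_oddMazurPrimes (hM : mazur_isogeny_irreducible) :
    SchneiderWeaken.TypeBRankOneUnridered ↔
      ∀ (W : WeierstrassCurve ℚ) [W.IsElliptic] [W.IsGloballyMinimal] (p : ℕ) [Fact p.Prime],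
        p ∈ ({3, 5, 7, 11, 13, 17, 19, 37, 43, 67, 163} : Finset ℕ) → X1.TypeBRankOne W p → BSDp W p := by
  refine ⟨fun h W _ _ p _ _ hB ↦ h W p hB, fun h W _ _ p _ hB ↦ ?_⟩
  exact h W p (mem_oddMazurPrimes_of_typeBRankOne hM W p hB) hB

end Summit.BirchSwinnertonDyer.BirchSwinnertonDyer.Theorems.DegenerateLocusA2PrimeSupport

end
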